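import Summits.CriticalPhenomena.PercolationContinuityZ3.Theorems.Transplant.SiteUnfold
import Summits.CriticalPhenomena.PercolationContinuityZ3.Theorems.Transplant.SiteCSHInduction
import Summits.CriticalPhenomena.PercolationContinuityZ3.Theorems.Transplant.SiteStarBridge
import HarnessLib

/-!
# SITE percolation: LEMMA U of the site conditioned slack hierarchy for GENERAL `k`, assembled, and the `hU` socket of the site induction
# DISCHARGED (WP6 of P1-SITE-Z3 §12/§15, closing WP6; site twin of `Theorems/PercNearOneGluingNoHeavyLowerTailCSHUnfoldMain.lean`)

builds on p205010 (kernel theorem, internal audit signed; external expert review pending).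

* **`within_unfold`** — the `{x↮Y}`-integral of the level-form margin of the site WORLD covariances `u ↦ Cov_{q^ω_Y}(g(C_x), 1{x↔u})` (the integrand
  of `SiteCSH.siteWithin`, p211724) EQUALS the H-part (world covariances with the SET indicators `1{o ↔ {x}∪D}`, `1{v ↔ {x}∪D}`, literally the bracket
  of `SiteCovTau.siteHpart_nonneg`, p214548) plus `subT(o) − p·subT(v)` (`SiteUnfold.subT`);
* `subT_comb_nonneg` — `subT(o) − p·subT(v) ≥ 0` from the lower-level margins (the induction hypothesis), `p = obsConst`;
* `within_nonneg_of_hpart` — the site within margin is `≥ 0` given the lower levels and `Hpart ≥ 0`;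
* **`siteWithin_nonneg_of_lower`** — the hypothesis `hU` of `SiteCSH.siteCSHAll_of_unfold` with NO remaining input (site Lemma U + site Lemma H).
After this file `SiteCSHAll` (⇒ `SiteAdditiveGluing` ⇒ site Conjecture 3, p210511) rests on exactly two sockets: hBase (site MDL(X)) and hT (site Lemma T).
Support file (`--supports stmt-CriticalPhenomena-4575 --as helper`); no definitions, no named facts, no sorries.
[cite: VandenbergHaggstromKahn2005, §2.1 Lemma 2.4 (p. 10); §1 display (10) (pp. 7–8)] [cite: KozmaNitzan2024, Conj. 4 (p. 32)]
-/

noncomputable section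

namespace Summit.CriticalPhenomena.PercolationContinuityZ3.Theorems.Transplant

namespace SiteCSH

open MeasureTheory Set
open Literature.Probability.Percolation
open Literature.Probability.Percolation.BHK2006 (weight weight_nonneg ind_inter integral_prodBernoulli_eq_sum)
open Literature.Probability.Percolation.DecisionTree (ind ind_of_mem ind_of_not_mem ind_nonneg)
open Literature.Probability.LatticeModels (prodBernoulli prodBernoulli_real_pos_of_nonempty)
open Summit.CriticalPhenomena.PercolationContinuityZ3.Theorems.CSH (slForm slForm_smul slForm_eq_sum_single cshMarg
  cshMarg_eq_sum_single slForm_jn jn_singleton)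
open Summit.CriticalPhenomena.PercolationContinuityZ3.Theorems.SiteTransplant (siteConn)
open SiteGen (siteCluster_mono' siteCluster_eq_of_mem mem_siteConn_iff_mem_siteCluster)
open SiteBHK (setC)
open scoped Classical

variable {V : Type*} {Γ : SimpleGraph V}

variable [Fintype V]

/-! ### Small dictionary -/

omit [Fintype V] in
/-- `u ↦ 1{x ↔ u}(ζ)` is `J_{{x}}` for the site relation of `ζ`. [folklore] -/
theorem ind_siteConn_eq_jn_singleton (x : V) (ζ : Set V) :
    (fun u => ind (siteConn Γ x u) ζ) = CSH.jn (fun a b => b ∈ siteCluster Γ ζ a) {x} := by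
  funext u; rw [← chi_rel_eq_ind ζ u x, jn_singleton]

omit [Fintype V] in
/-- `{ζ | ∃ s ∈ S, s ∈ C_u(ζ)} = ⋃_{t ∈ S} {u ↔ t}` for a finite set `S`. [folklore] -/
theorem setOf_exists_mem_siteCluster_eq_iUnion (S : Finset V) (u : V) :
    {ζ : Set V | ∃ s ∈ (↑S : Set V), s ∈ siteCluster Γ ζ u} = ⋃ t ∈ S, siteConn Γ u t := by
  ext ζ
  simp only [Set.mem_setOf_eq, Set.mem_iUnion, Finset.mem_coe, exists_prop, mem_siteConn_iff_mem_siteCluster]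

/-! ### The main identity -/

/-- **SITE LEMMA U FOR GENERAL `k`**: the `{x↮Y}`-integral of the margin of the world covariances `u ↦ Cov_{q^ω}(g(C_x), 1{x↔u})` equals the
H-part (world covariances with the SET indicators `1{o ↔ {x}∪D}`, `1{v ↔ {x}∪D}`) plus `subT(o) − p·subT(v)`; for any real `p` and any decoy list.
[cite: VandenbergHaggstromKahn2005, §2.1 Lemma 2.4 (p. 10); §1 display (10) (pp. 7–8) — corollaries] -/
theorem within_unfold (q : V → unitInterval) (hq : ∀ u, 0 < q u ∧ q u < 1) (x : V) (Y : Set V) (D : List V) (o v : V)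
    (g : Set V → ℝ) (p : ℝ) :
    ∫ ω in {ω : Set V | ∀ y ∈ Y, y ∉ siteCluster Γ ω x},
        cshMarg (decoyList Γ q (insert x Y) D) p o v
          (fun u => (∫ η in siteConn Γ x u, g (siteCluster Γ η x) ∂(prodBernoulli (worldQ Γ q Y ω))) -
            (∫ η, g (siteCluster Γ η x) ∂(prodBernoulli (worldQ Γ q Y ω))) *
              (prodBernoulli (worldQ Γ q Y ω)).real (siteConn Γ x u))
        ∂(prodBernoulli q) =
      (∫ ω in {ω : Set V | ∀ y ∈ Y, y ∉ siteCluster Γ ω x},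
        (((∫ η in (⋃ t ∈ insert x D.toFinset, siteConn Γ o t), g (siteCluster Γ η x) ∂(prodBernoulli (worldQ Γ q Y ω))) -
            (prodBernoulli (worldQ Γ q Y ω)).real (⋃ t ∈ insert x D.toFinset, siteConn Γ o t) *
              (∫ η, g (siteCluster Γ η x) ∂(prodBernoulli (worldQ Γ q Y ω)))) -
          p * ((∫ η in (⋃ t ∈ insert x D.toFinset, siteConn Γ v t), g (siteCluster Γ η x) ∂(prodBernoulli (worldQ Γ q Y ω))) -
            (prodBernoulli (worldQ Γ q Y ω)).real (⋃ t ∈ insert x D.toFinset, siteConn Γ v t) *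
              (∫ η, g (siteCluster Γ η x) ∂(prodBernoulli (worldQ Γ q Y ω)))))
        ∂(prodBernoulli q)) +
      (subT Γ q x Y g o {x} D - p * subT Γ q x Y g v {x} D) := by
  set ŵ : V → ℝ := fun u => (q u : ℝ) with hŵ
  have hm : ∑ ω, weight ŵ ω = 1 := by
    have h1 := integral_prodBernoulli_eq_sum q fun _ => (1 : ℝ)
    simp only [integral_const, probReal_univ, smul_eq_mul, mul_one] at h1
    exact h1.symm
  set L := decoyList Γ q (insert x Y) D with hLdef
  set G : Set V → ℝ := fun β => g (siteCluster Γ β x) with hG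
  have hDev : {ω : Set V | ∀ y ∈ Y, y ∉ siteCluster Γ ω x} = avoid Γ x Y := rfl
  have hL' : L = decoyList Γ q ({x} ∪ Y) D := by rw [hLdef, ← Set.insert_eq]
  have hdecs : {d : V | d ∈ L.map Prod.fst} = {d | d ∈ D} := by rw [hLdef, map_fst_decoyList]
  set Sset : Set V := {x} ∪ {d | d ∈ D} with hSset
  have hSfin : (↑(insert x D.toFinset) : Set V) = Sset := by
    ext u; simp [hSset]
  -- the world test functions
  set Jf : V → Set V → ℝ := fun u ζ => CSH.jn (fun a b => b ∈ siteCluster Γ ζ a) Sset u with hJf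
  set Tf : V → Set V → ℝ := fun u ζ => CSH.unfoldT (fun a b => b ∈ siteCluster Γ ζ a) {x} L u with hTf
  -- Step A: the integrand is a world covariance margin (sum vocabulary)
  rw [hDev, setIntegral_eq_sum_ind', setIntegral_eq_sum_ind']
  simp only [world_cov_eq_wcovOff]
  -- Step B: pointwise unfolding of the margin of the world covariances
  have stepB : ∀ ω, cshMarg L p o v (fun u => wcovOff Γ ŵ Y G (ind (siteConn Γ x u)) ω) =
      wcovOff Γ ŵ Y G (Jf o) ω - p * wcovOff Γ ŵ Y G (Jf v) ω - wcovOff Γ ŵ Y G (Tf o) ω + p * wcovOff Γ ŵ Y G (Tf v) ω := by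
    intro ω
    rw [cshMarg_eq_sum_single, wcovOff_finset_sum]
    have inner : (fun ζ => ∑ u, cshMarg L p o v (Pi.single u (1 : ℝ)) * ind (siteConn Γ x u) ζ) =
        fun ζ => (Jf o ζ - p * Jf v ζ) - (Tf o ζ - p * Tf v ζ) + (CSH.unfoldK L o - p * CSH.unfoldK L v) := by
      funext ζ
      rw [← cshMarg_eq_sum_single L p o v (fun u => ind (siteConn Γ x u) ζ), ind_siteConn_eq_jn_singleton]
      simp only [cshMarg, slForm_jn (fun a b => b ∈ siteCluster Γ ζ a) (siteRel_symm ζ) (siteRel_trans ζ) L {x}, hdecs,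
        hJf, hTf, hSset]
      ring
    rw [inner, wcovOff_affine ŵ hm]
  -- Step C: sum over ω; the `unfoldT` parts are `−subT`
  have stepCo := sum_wcov_unfoldT q hq x Y g o D {x} (Set.mem_singleton x) (Γ := Γ)
  have stepCv := sum_wcov_unfoldT q hq x Y g v D {x} (Set.mem_singleton x) (Γ := Γ)
  rw [← hL'] at stepCo stepCv
  have e : ∀ ω, weight ŵ ω * (ind (avoid Γ x Y) ω *
      cshMarg L p o v (fun u => wcovOff Γ ŵ Y G (ind (siteConn Γ x u)) ω)) =
      weight ŵ ω * (ind (avoid Γ x Y) ω * (wcovOff Γ ŵ Y G (Jf o) ω - p * wcovOff Γ ŵ Y G (Jf v) ω)) -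
        weight ŵ ω * (ind (avoid Γ x Y) ω * wcovOff Γ ŵ Y G (Tf o) ω) +
        p * (weight ŵ ω * (ind (avoid Γ x Y) ω * wcovOff Γ ŵ Y G (Tf v) ω)) := by
    intro ω; rw [stepB ω]; ring
  rw [Finset.sum_congr rfl (fun ω _ => e ω), Finset.sum_add_distrib, Finset.sum_sub_distrib, ← Finset.mul_sum]
  change (∑ ω, weight ŵ ω * (ind (avoid Γ x Y) ω * (wcovOff Γ ŵ Y G (Jf o) ω - p * wcovOff Γ ŵ Y G (Jf v) ω))) -
      (∑ ω, weight ŵ ω * (ind (avoid Γ x Y) ω * wcovOff Γ ŵ Y G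
        (fun ζ => CSH.unfoldT (fun a b => b ∈ siteCluster Γ ζ a) {x} L o) ω)) +
      p * (∑ ω, weight ŵ ω * (ind (avoid Γ x Y) ω * wcovOff Γ ŵ Y G
        (fun ζ => CSH.unfoldT (fun a b => b ∈ siteCluster Γ ζ a) {x} L v) ω)) = _
  rw [stepCo, stepCv]
  -- Step D: the H-part back in measure form
  have hJ : ∀ u, Jf u = ind (⋃ t ∈ insert x D.toFinset, siteConn Γ u t) := by
    intro u; funext ζ
    rw [hJf]
    dsimp only
    rw [jn_rel_eq_ind, ← setOf_exists_mem_siteCluster_eq_iUnion, hSfin]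
  have eH : ∀ ω, weight ŵ ω * (ind (avoid Γ x Y) ω * (wcovOff Γ ŵ Y G (Jf o) ω - p * wcovOff Γ ŵ Y G (Jf v) ω)) =
      weight ŵ ω * (ind (avoid Γ x Y) ω *
        (wcovOff Γ ŵ Y G (ind (⋃ t ∈ insert x D.toFinset, siteConn Γ o t)) ω -
          p * wcovOff Γ ŵ Y G (ind (⋃ t ∈ insert x D.toFinset, siteConn Γ v t)) ω)) := by
    intro ω; rw [hJ o, hJ v]
  rw [Finset.sum_congr rfl (fun ω _ => eH ω)]
  have eM : ∀ ω, weight ŵ ω * (ind (avoid Γ x Y) ω *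
      (((∫ η in (⋃ t ∈ insert x D.toFinset, siteConn Γ o t), g (siteCluster Γ η x) ∂(prodBernoulli (worldQ Γ q Y ω))) -
          (prodBernoulli (worldQ Γ q Y ω)).real (⋃ t ∈ insert x D.toFinset, siteConn Γ o t) *
            (∫ η, g (siteCluster Γ η x) ∂(prodBernoulli (worldQ Γ q Y ω)))) -
        p * ((∫ η in (⋃ t ∈ insert x D.toFinset, siteConn Γ v t), g (siteCluster Γ η x) ∂(prodBernoulli (worldQ Γ q Y ω))) -
          (prodBernoulli (worldQ Γ q Y ω)).real (⋃ t ∈ insert x D.toFinset, siteConn Γ v t) *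
            (∫ η, g (siteCluster Γ η x) ∂(prodBernoulli (worldQ Γ q Y ω)))))) =
      weight ŵ ω * (ind (avoid Γ x Y) ω *
        (wcovOff Γ ŵ Y G (ind (⋃ t ∈ insert x D.toFinset, siteConn Γ o t)) ω -
          p * wcovOff Γ ŵ Y G (ind (⋃ t ∈ insert x D.toFinset, siteConn Γ v t)) ω)) := by
    intro ω
    rw [← world_cov_eq_wcovOff q Y ω G, ← world_cov_eq_wcovOff q Y ω G]
    ring
  rw [Finset.sum_congr rfl (fun ω _ => eM ω)]
  ring

/-! ### The lower-level terms are nonnegative given the lower levels -/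

/-- **`subT(o) − p·subT(v) ≥ 0` from the lower levels** (site): along the splittings `D₀ = pre ++ rest`, with the source set `S = {x} ∪ pre`,
`subT_S(rest)(o) − p·subT_S(rest)(v) = Σ_{d ∈ rest} μ(E_d)⁻¹ · cshMargin Γ q d ({x}∪Y∪pre_d) rest_{>d} o v Φ̃_d`, each term nonnegative when the
lower-level margins at the monotone nonnegative functionals `Φ̃_d` are (hypothesis `hIH`) and `p = obsConst Γ q o v ({x} ∪ Y ∪ D₀)`.
[cite: KozmaNitzan2024, Conj. 4 (p. 32)] -/
theorem subT_comb_nonneg (q : V → unitInterval) (x : V) (Y : Set V) (D₀ : List V) (o v : V) {g : Set V → ℝ}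
    (hg : Monotone g)
    (hIH : ∀ (pre : List V) (d : V) (ds' : List V), D₀ = pre ++ d :: ds' →
      ∀ h : Set V → ℝ, Monotone h → (∀ C, 0 ≤ h C) →
        0 ≤ cshMargin Γ q d (insert x Y ∪ {e | e ∈ pre}) ds' o v h) :
    ∀ (rest pre : List V), D₀ = pre ++ rest →
      0 ≤ subT Γ q x Y g o ({x} ∪ {e | e ∈ pre}) rest -
        obsConst Γ q o v (insert x Y ∪ {d | d ∈ D₀}) * subT Γ q x Y g v ({x} ∪ {e | e ∈ pre}) rest := by
  intro rest
  induction rest with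
  | nil => intro pre _; simp [subT]
  | cons d ds ih =>
    intro pre hsplit
    set A : Set V := {x} ∪ {e | e ∈ pre} ∪ Y with hA
    have hA' : A = insert x Y ∪ {e | e ∈ pre} := by
      ext u; simp only [hA, Set.mem_union, Set.mem_singleton_iff, Set.mem_setOf_eq, Set.mem_insert_iff]; tauto
    have hset : insert d A ∪ {e | e ∈ ds} = insert x Y ∪ {e | e ∈ D₀} := by
      ext u
      simp only [hA, hsplit, Set.mem_union, Set.mem_insert_iff, Set.mem_singleton_iff, Set.mem_setOf_eq, List.mem_append,
        List.mem_cons]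
      tauto
    -- the head term is `μ(E)⁻¹ · cshMargin Γ q d A ds o v Φ̃_d ≥ 0`
    have hmargin : slForm (decoyList Γ q (insert d A) ds) (covD Γ q d A (phiT Γ q x Y g d)) o -
        obsConst Γ q o v (insert x Y ∪ {e | e ∈ D₀}) * slForm (decoyList Γ q (insert d A) ds) (covD Γ q d A (phiT Γ q x Y g d)) v =
        cshMargin Γ q d (insert x Y ∪ {e | e ∈ pre}) ds o v (phiT Γ q x Y g d) := by
      rw [← hset, ← hA']; rfl
    have hhead : 0 ≤ cshMargin Γ q d (insert x Y ∪ {e | e ∈ pre}) ds o v (phiT Γ q x Y g d) :=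
      hIH pre d ds hsplit (phiT Γ q x Y g d) (phiT_mono q x Y hg d) (fun K => phiT_nonneg q x Y hg d K)
    have hinv : 0 ≤ ((prodBernoulli q).real (avoid Γ d A))⁻¹ := inv_nonneg.2 measureReal_nonneg
    -- the tail by induction with `pre ++ [d]`
    have htail := ih (pre ++ [d]) (by rw [hsplit]; simp)
    have hS' : ({x} ∪ {e | e ∈ pre ++ [d]} : Set V) = insert d ({x} ∪ {e | e ∈ pre}) := by
      ext u
      simp only [Set.mem_union, Set.mem_singleton_iff, Set.mem_setOf_eq, List.mem_append, List.mem_singleton, Set.mem_insert_iff]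
      tauto
    rw [hS'] at htail
    have hSY : ({x} ∪ {e | e ∈ pre} : Set V) ∪ Y = A := rfl
    simp only [subT, hSY]
    have key : ((prodBernoulli q).real (avoid Γ d A))⁻¹ *
          slForm (decoyList Γ q (insert d A) ds) (covD Γ q d A (phiT Γ q x Y g d)) o +
        subT Γ q x Y g o (insert d ({x} ∪ {e | e ∈ pre})) ds -
        obsConst Γ q o v (insert x Y ∪ {d | d ∈ D₀}) *
          (((prodBernoulli q).real (avoid Γ d A))⁻¹ *
              slForm (decoyList Γ q (insert d A) ds) (covD Γ q d A (phiT Γ q x Y g d)) v +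
            subT Γ q x Y g v (insert d ({x} ∪ {e | e ∈ pre})) ds) =
        ((prodBernoulli q).real (avoid Γ d A))⁻¹ * cshMargin Γ q d (insert x Y ∪ {e | e ∈ pre}) ds o v (phiT Γ q x Y g d) +
          (subT Γ q x Y g o (insert d ({x} ∪ {e | e ∈ pre})) ds -
            obsConst Γ q o v (insert x Y ∪ {d | d ∈ D₀}) * subT Γ q x Y g v (insert d ({x} ∪ {e | e ∈ pre})) ds) := by
      rw [← hmargin]; ring
    rw [key]
    exact add_nonneg (mul_nonneg hinv hhead) htail

/-- **The site within-margin is nonnegative given the lower levels and the H-part** — the hypothesis `hU` of `SiteCSH.siteCshMargin_nonneg_of_unfold`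
(p211724) modulo site LEMMA H: for non-degenerate weights, `g` monotone, `0 ≤ Hpart` (`hHP`, the conclusion of `SiteCovTau.siteHpart_nonneg` at
`S = {x} ∪ D`, `p = obsConst Γ q o v ({x}∪Y∪D)`) and the lower-level margins nonnegative (`hIH`) imply `0 ≤ siteWithin Γ q x Y D o v g`.
[cite: KozmaNitzan2024, Conj. 4 (p. 32)] -/
theorem within_nonneg_of_hpart (q : V → unitInterval) (hq : ∀ u, 0 < q u ∧ q u < 1) (x : V) (Y : Set V) (D : List V)
    (o v : V) {g : Set V → ℝ} (hg : Monotone g)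
    (hIH : ∀ (pre : List V) (d : V) (ds' : List V), D = pre ++ d :: ds' →
      ∀ h : Set V → ℝ, Monotone h → (∀ C, 0 ≤ h C) →
        0 ≤ cshMargin Γ q d (insert x Y ∪ {e | e ∈ pre}) ds' o v h)
    (hHP : 0 ≤ ∫ ω in {ω : Set V | ∀ y ∈ Y, y ∉ siteCluster Γ ω x},
        (((∫ η in (⋃ t ∈ insert x D.toFinset, siteConn Γ o t), g (siteCluster Γ η x) ∂(prodBernoulli (worldQ Γ q Y ω))) -
            (prodBernoulli (worldQ Γ q Y ω)).real (⋃ t ∈ insert x D.toFinset, siteConn Γ o t) *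
              (∫ η, g (siteCluster Γ η x) ∂(prodBernoulli (worldQ Γ q Y ω)))) -
          obsConst Γ q o v (insert x Y ∪ {d | d ∈ D}) *
            ((∫ η in (⋃ t ∈ insert x D.toFinset, siteConn Γ v t), g (siteCluster Γ η x) ∂(prodBernoulli (worldQ Γ q Y ω))) -
              (prodBernoulli (worldQ Γ q Y ω)).real (⋃ t ∈ insert x D.toFinset, siteConn Γ v t) *
                (∫ η, g (siteCluster Γ η x) ∂(prodBernoulli (worldQ Γ q Y ω)))))
        ∂(prodBernoulli q)) :
    0 ≤ siteWithin Γ q x Y D o v g := by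
  unfold siteWithin
  rw [within_unfold q hq x Y D o v g]
  have hsub := subT_comb_nonneg q x Y D o v hg hIH D [] (by simp) (Γ := Γ)
  have hS0 : ({x} ∪ {e | e ∈ ([] : List V)} : Set V) = {x} := by ext u; simp
  rw [hS0] at hsub
  exact add_nonneg hHP hsub

end SiteCSH

/-! ### The `hU` socket of the site induction, discharged -/

namespace SiteCSH

open MeasureTheory Set
open Literature.Probability.LatticeModels (prodBernoulli)
open Literature.Probability.Percolation
open scoped Classical

variable {n : ℕ} {Δ : SimpleGraph (Fin n)}

/-- **LEMMAS U + H (site), unconditionally: the hypothesis `hU` of `SiteCSH.siteCSHAll_of_unfold`** (p211724).  For non-degenerate vertex weights,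
distinct data and a nonempty decoy list, if every lower-level margin is nonnegative then the site within margin is nonnegative for every monotone
`g ≥ 0` — site Lemma U (`within_nonneg_of_hpart`, this file) + site Lemma H (`SiteCovTau.siteHpart_nonneg`, p214433).  With this, `SiteCSHAll`
(hence `SiteAdditiveGluing`, site Conjecture 3) is reduced to the two remaining sockets hBase (site MDL(X), WP2) and hT (site Lemma T, WP1).
[cite: VandenbergHaggstromKahn2005, §2.1 (pp. 9–13)] [cite: KozmaNitzan2024, Conj. 4 (p. 32)] -/
theorem siteWithin_nonneg_of_lower (q : Fin n → unitInterval) (hq : ∀ u, 0 < q u ∧ q u < 1)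
    (x : Fin n) (Y : Set (Fin n)) (D : List (Fin n)) (o v : Fin n)
    (_hxY : x ∉ Y) (_ho : o ∉ insert x Y) (_hv : v ∉ insert x Y) (_hov : o ≠ v) (_hne : D ≠ []) (_hnd : D.Nodup)
    (_hdis : ∀ d ∈ D, d ∉ insert x Y ∧ d ≠ o ∧ d ≠ v)
    (hIH : ∀ (pre : List (Fin n)) (d : Fin n) (ds' : List (Fin n)), D = pre ++ d :: ds' →
      ∀ h : Set (Fin n) → ℝ, Monotone h → (∀ C, 0 ≤ h C) → 0 ≤ cshMargin Δ q d (insert x Y ∪ {e | e ∈ pre}) ds' o v h)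
    (g : Set (Fin n) → ℝ) (hg : Monotone g) (hg0 : ∀ C, 0 ≤ g C) :
    0 ≤ siteWithin Δ q x Y D o v g := by
  refine within_nonneg_of_hpart q hq x Y D o v hg hIH ?_
  have hS : ((↑(insert x D.toFinset) : Set (Fin n)) ∪ Y) = insert x Y ∪ {d | d ∈ D} := by
    ext u
    simp only [Finset.coe_insert, mem_union, mem_insert_iff, Finset.mem_coe, List.mem_toFinset, mem_setOf_eq]
    tauto
  have key := SiteCovTau.siteHpart_nonneg (Δ := Δ) q hq x Y (insert x D.toFinset) (Finset.mem_insert_self x _) o v g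
    (fun C C' h => hg h) hg0
  rw [hS] at key
  -- the two statements agree up to the (subsingleton) `DecidableEq` instance inside `List.toFinset`
  convert key using 20

end SiteCSH

end Summit.CriticalPhenomena.PercolationContinuityZ3.Theorems.Transplant
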